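import Summits.CriticalPhenomena.SAWScalingLimit.Theses.SAWChargeContinuation
import Summits.CriticalPhenomena.SAWScalingLimit.Theorems.SAWChargeContinuationAnchorExcursionLattice
import Summits.CriticalPhenomena.SAWScalingLimit.Theorems.SAWLoopFugacityFlowAvoidanceLimitExcursionRatioSelf

/-!
# `AnchorExcursion` (stmt-CriticalPhenomena-11196) reduced to the Green's-ratio invariance
# principle; the instance `D' = D`

Route `SAWChargeContinuation` of `CriticalPhenomena/SAWScalingLimit`, support item `AnchorExcursion`:
along every endpoint approximation `a_δ, b_δ` of the marked points of a Dobrushin domain `D`, for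
every hull subdomain `D'` with restriction data `(φ, Φ, d = Φ'_A(0))`,
`R_δ := Z(D_δ|D'; 1, 1/4) / Z(D_δ; 1, 1/4) → d`.

By the lattice identity of the companion file (`tsum_domainSAW_complex_eq`: at charge `s = 1` and
fugacity `y = 1/4` the loop-measure-dressed SAW sum over a sub-graph `H ≤ D_δ` IS the Green's
function of the simple random walk killed off `H`, Lawler 2018 Prop. 3.1 + 5.2),
`R_δ = G_{W_δ}(a_δ, b_δ) / G_{D_δ}(a_δ, b_δ)` with `W_δ` the item's window graph (edges of `D_δ`
inside `cl D'` between mesh points of `D'`) — the probability that the random-walk excursion from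
`a_δ` to `b_δ` in `D_δ` (the walk weighted by its visits to `b_δ`) only uses the window graph.
This file proves:

* bookkeeping: the window graph is a sub-graph of `D_δ` and is all of `D_δ` when `D' = D`
  (`windowGraph_le`, `windowGraph_self_eq`); the denominator `G_{D_δ}(a_δ, b_δ)` is eventually
  positive and finite (`eventually_rwGreen_pos_ne_top`); a hull subdomain agrees with the domain
  on balls about the marked points (`exists_ball_inter_eq`);
* `anchorExcursion_self` — **the instance `D' = D` of the item's conclusion**: the window graph of
  `D` itself is `D_δ` (`windowGraph_self_eq`), so `R_δ = 1` eventually, while the pulled-back hull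
  of `D' = D` is empty and `d = Φ'_∅(0) = 1` (`restrictionDeriv_eq_one_of_self`, landed for the
  sibling crux `SAWLoopFugacityFlow.AvoidanceLimit`) — a check of both normalisations;
* `anchorExcursion_of_greenRatioInvariance` — **REDUCTION**: `AnchorExcursion` follows from the ONE
  lattice → continuum input missing from the tree, the Green's-function-RATIO invariance principle
  for the simple random walk killed off a rough (Jordan) lattice domain at its two marked prime
  ends: `G_{W_δ}(a_δ,b_δ)/G_{D_δ}(a_δ,b_δ) − G_{ℍ∖A}(u_δ,v_δ)/G_ℍ(u_δ,v_δ) → 0` at the uniformized legs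
  `u_δ = φ⁻¹(δ a_δ) → 0`, `v_δ = φ⁻¹(δ b_δ) → ∞` (`G_ℍ(x,y) = log(|x − ȳ|/|x − y|)`,
  `G_{ℍ∖A} = G_ℍ ∘ Φ_A`). Given it, the item is the landed continuum limit
  `tendsto_greenHalfPlane_ratio` (`G_{ℍ∖A}(u,v)/G_ℍ(u,v) → Φ'_A(0)` as `(u,v) → (0,∞)` inside
  `ℍ ∖ A`, [LSW03] Prop. 4.1 in Green's-function form) at the legs
  (`tendsto_symm_meshPoint_fst/snd`, Carathéodory boundary correspondence of the chordal
  uniformizer). In print the hypothesis is Kozdron–Lawler 2005 (EJP 10) Thm. 1.1 / Prop. 3.10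
  (grid domains, macroscopically separated boundary points; tree: the named facts
  `KozdronLawler_excursionPoissonKernel`, `KozdronLawler_greenFunctionBoundary`) composed with a
  `δ`-uniform boundary Harnack principle at the two prime ends (Chelkak 2016 §3) — not a single
  printed theorem, hence a hypothesis here and not a Literature fact.

Sources: G. F. Lawler, *Topics in loop measures and the loop-erased walk* (2018), Prop. 3.1, 5.2
[Lawler2018]; M. J. Kozdron, G. F. Lawler, EJP 10 (2005), Thm. 1.1 [KozdronLawler2005];
G. F. Lawler, O. Schramm, W. Werner, *Conformal restriction: the chordal case* (2003), Prop. 4.1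
[LawlerSchrammWerner2003Restriction]. No definitions.
-/

noncomputable section

open scoped ENNReal Topology ComplexConjugate
open Filter Literature.Probability.RandomPlanarGeometry Literature.Probability.LatticeModels
open Summit.CriticalPhenomena.SAWScalingLimit.Theses.SAWChargeContinuation

namespace Summit.CriticalPhenomena.SAWScalingLimit.Theorems.AnchorExcursion

/-! ## The window graph of the item -/

section Window

variable {Ω Ω' : Set ℂ} {δ : ℝ}

/-- The item's window graph `G Ω Ω' δ` (edges of `Ω_δ` that are mesh edges of `Ω'` between mesh
points of `Ω'`) is a sub-graph of `Ω_δ`. [folklore] -/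
theorem windowGraph_le (Ω Ω' : Set ℂ) (δ : ℝ) :
    (SimpleGraph.fromRel fun x y => (discreteDomainGraph Ω δ).Adj x y ∧ (meshGraph Ω' δ).Adj x y ∧
      x ∈ meshVertices Ω' δ ∧ y ∈ meshVertices Ω' δ) ≤ discreteDomainGraph Ω δ := by
  intro x y h
  rw [SimpleGraph.fromRel_adj] at h
  rcases h.2 with h' | h'
  · exact h'.1
  · exact h'.1.symm

/-- With `Ω' = Ω` the window graph is all of `Ω_δ` (an edge of `Ω_δ` is a mesh edge of `Ω` between
vertices of `meshDomain Ω δ ⊆ meshVertices Ω δ`). [folklore] -/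
theorem windowGraph_self_eq (Ω : Set ℂ) (δ : ℝ) :
    (SimpleGraph.fromRel fun x y => (discreteDomainGraph Ω δ).Adj x y ∧ (meshGraph Ω δ).Adj x y ∧
      x ∈ meshVertices Ω δ ∧ y ∈ meshVertices Ω δ) = discreteDomainGraph Ω δ := by
  refine le_antisymm (windowGraph_le Ω Ω δ) fun x y h => ?_
  rw [SimpleGraph.fromRel_adj]
  have h' := discreteDomainGraph_adj_iff.1 h
  exact ⟨h.ne, Or.inl ⟨h, h'.1, meshDomain_subset_meshVertices Ω δ h'.2.1,
    meshDomain_subset_meshVertices Ω δ h'.2.2⟩⟩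

end Window

/-! ## The item's quotient is a ratio of killed Green's functions -/

section Ratio

variable {D D' : DobrushinDomain} {a b : ℝ → Site 2}

/-- Along an endpoint approximation the denominator Green's function `G_{D_δ}(a_δ, b_δ)` is
eventually positive (the legs are joined in `D_δ`) and finite (the legs lie in the finite `D_δ`).
[folklore] -/
theorem eventually_rwGreen_pos_ne_top (hab : SAW.IsEndpointApprox D a b) :
    ∀ᶠ δ in 𝓝[>] (0 : ℝ), 0 < rwGreen (discreteDomainGraph D.carrier δ) (a δ) (b δ) ∧
      rwGreen (discreteDomainGraph D.carrier δ) (a δ) (b δ) ≠ ⊤ := by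
  filter_upwards [self_mem_nhdsWithin, hab.reachable,
    AvoidanceLimit.Anchor.eventually_mem_meshDomain hab] with δ hδ hreach hmem
  exact ⟨rwGreen_pos_of_reachable hreach,
    rwGreen_domain_ne_top le_rfl D.isBounded hδ hmem.2.1 hmem.2.2⟩

/-- A hull subdomain agrees with the domain on balls around the two marked points. [folklore] -/
theorem exists_ball_inter_eq (h : D.IsHullSubdomain D') :
    ∃ ε : ℝ, 0 < ε ∧ D'.carrier ∩ Metric.ball (D.pt 0) ε = D.carrier ∩ Metric.ball (D.pt 0) ε ∧
      D'.carrier ∩ Metric.ball (D.pt 1) ε = D.carrier ∩ Metric.ball (D.pt 1) ε := by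
  obtain ⟨ε₀, hε₀, h₀⟩ := Metric.eventually_nhds_iff_ball.1 (h.eventually_mem 0)
  obtain ⟨ε₁, hε₁, h₁⟩ := Metric.eventually_nhds_iff_ball.1 (h.eventually_mem 1)
  refine ⟨min ε₀ ε₁, lt_min hε₀ hε₁, ?_, ?_⟩
  · ext z
    refine ⟨fun hz => ⟨h.carrier_subset hz.1, hz.2⟩, fun hz => ⟨?_, hz.2⟩⟩
    exact h₀ z (Metric.ball_subset_ball (min_le_left _ _) hz.2) hz.1
  · ext z
    refine ⟨fun hz => ⟨h.carrier_subset hz.1, hz.2⟩, fun hz => ⟨?_, hz.2⟩⟩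
    exact h₁ z (Metric.ball_subset_ball (min_le_right _ _) hz.2) hz.1

end Ratio

/-! ## The instance `D' = D` and the reduction -/

open scoped Classical in
/-- **`AnchorExcursion` in the instance `D' = D`**: for every Dobrushin domain `D`, endpoint
approximation, chordal uniformizer `φ` and restriction data `(Φ, d)` of the pulled-back hull of
`D' := D` (which is EMPTY, so `Φ = id` and `d = 1`), the item's quotient
`Z(D_δ|D; 1, 1/4)/Z(D_δ; 1, 1/4)` tends to `d`: the window graph of `D` is `D_δ` itself, both
partition functions are the Green's function `G_{D_δ}(a_δ, b_δ) ∈ (0, ∞)` eventually, the quotient is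
eventually `1`, and `d = Φ'_∅(0) = 1`. A check of the two normalisations (denominator non-zero;
restriction derivative pinned), in the item's literal typing. [folklore] -/
theorem anchorExcursion_self :
    let pb : (D : DobrushinDomain) → ConformalEquiv UpperHalfPlane.upperHalfPlaneSet D.carrier →
        DobrushinDomain → Set ℂ := fun _ φ D' =>
      closure (UpperHalfPlane.upperHalfPlaneSet \ {z | z ∈ UpperHalfPlane.upperHalfPlaneSet ∧ φ z ∈ D'.carrier})
    let G : Set ℂ → Set ℂ → ℝ → SimpleGraph (Site 2) := fun Ω Ω' δ =>
      SimpleGraph.fromRel fun x y => (discreteDomainGraph Ω δ).Adj x y ∧ (meshGraph Ω' δ).Adj x y ∧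
        x ∈ meshVertices Ω' δ ∧ y ∈ meshVertices Ω' δ
    let m : (Ω Ω' : Set ℂ) → (δ : ℝ) → (a b : Site 2) → SAW.DomainSAW Ω δ a b → ℝ :=
      fun Ω Ω' δ _ _ γ => ∑' p : (Σ x : Site 2, (G Ω Ω' δ).Walk x x),
        if 0 < p.2.length ∧ (∃ v ∈ p.2.support, v ∈ γ.walk.support) then
          (1 / 4 : ℝ) ^ p.2.length / (p.2.length : ℝ) else 0
    let Z : (Ω Ω' : Set ℂ) → (δ : ℝ) → (a b : Site 2) → ℂ → ℂ → ℂ := fun Ω Ω' δ a b s y =>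
      ∑' γ : SAW.DomainSAW Ω δ a b,
        if (∀ e ∈ γ.walk.darts, (G Ω Ω' δ).Adj e.fst e.snd) then
          y ^ γ.length * Complex.exp (s * (m Ω Ω' δ a b γ : ℂ)) else 0
    ∀ (D : DobrushinDomain) (a b : ℝ → Site 2), SAW.IsEndpointApprox D a b →
      ∀ (φ : ConformalEquiv UpperHalfPlane.upperHalfPlaneSet D.carrier), D.IsChordalUniformizing φ →
      ∀ (Φ : ConformalEquiv (UpperHalfPlane.upperHalfPlaneSet \ pb D φ D) UpperHalfPlane.upperHalfPlaneSet)
        (d : ℝ), IsRestrictionMap (pb D φ D) Φ → HasRestrictionDeriv (pb D φ D) Φ d →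
      Tendsto (fun δ => Z D.carrier D.carrier δ (a δ) (b δ) 1 (1 / 4) /
        Z D.carrier D.carrier δ (a δ) (b δ) 1 (1 / 4)) (𝓝[>] 0) (𝓝 (d : ℂ)) := by
  intro pb G m Z D a b hab φ _hφ Φ d hΦ hd
  have hpb : pb D φ D = φ.pullbackHull D := rfl
  have hd1 : d = 1 := AvoidanceLimit.Anchor.restrictionDeriv_eq_one_of_self φ hpb hΦ hd
  subst hd1
  refine (tendsto_const_nhds (x := ((1 : ℝ) : ℂ))).congr' ?_
  filter_upwards [self_mem_nhdsWithin, eventually_rwGreen_pos_ne_top hab] with δ hδ hpos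
  have hδ' : (0 : ℝ) < δ := hδ
  have hZ : Z D.carrier D.carrier δ (a δ) (b δ) 1 (1 / 4) =
      ((rwGreen (discreteDomainGraph D.carrier δ) (a δ) (b δ)).toReal : ℂ) := by
    simp only [Z, m]
    conv_rhs => rw [← windowGraph_self_eq D.carrier δ]
    exact tsum_domainSAW_complex_eq (windowGraph_le D.carrier D.carrier δ)
      (edgeSet_finite_of_le (windowGraph_le D.carrier D.carrier δ) D.isBounded hδ') (a δ) (b δ) _ _
  rw [hZ, div_self]
  · simp
  · exact_mod_cast (ENNReal.toReal_pos hpos.1.ne' hpos.2).ne'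

/-- **REDUCTION: `AnchorExcursion` follows from the Green's-function-ratio invariance principle.**
The hypothesis is the ONE lattice → continuum input that is not in the tree: along the data of the
item (Dobrushin domain `D`, hull subdomain `D'`, endpoint approximation `a_δ, b_δ`, chordal
uniformizer `φ`, restriction map `Φ` of the pulled-back hull `A = φ.pullbackHull D'`), the ratio of
killed simple-random-walk Green's functions "window graph of `D'` over `D_δ`" between the legs is
asymptotic to the ratio of CONTINUUM Green's functions `G_{ℍ∖A}(u_δ, v_δ)/G_ℍ(u_δ, v_δ)` at the
uniformized legs `u_δ = φ⁻¹(δ a_δ)`, `v_δ = φ⁻¹(δ b_δ)` (`G_ℍ(x, y) = log(|x − ȳ|/|x − y|)`,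
`G_{ℍ∖A}(u, v) = G_ℍ(Φu, Φv)` by conformal invariance) — an invariance principle for the walk
killed outside a rough (Jordan) lattice domain, in RATIO form, uniform down to the two marked prime
ends (print: Kozdron–Lawler 2005 Thm. 1.1 / Prop. 3.10 for grid domains with separated boundary
points, plus a `δ`-uniform boundary Harnack principle; NOT a single printed theorem). Given it, the
item is the lattice identity `Z(D_δ|·; 1, 1/4) = G` (`tsum_domainSAW_complex_eq`) and the landed
continuum limit `tendsto_greenHalfPlane_ratio` at `(u_δ, v_δ) → (0, ∞)` inside `ℍ ∖ A`
(`tendsto_symm_meshPoint_fst/snd`; `A` is a `*`-hull, `IsStarHull.pullbackHull`).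
[cite: KozdronLawler2005, Thm. 1.1] -/
theorem anchorExcursion_of_greenRatioInvariance
    (hX : ∀ (D D' : DobrushinDomain) (a b : ℝ → Site 2), SAW.IsEndpointApprox D a b →
      D.IsHullSubdomain D' →
      ∀ (φ : ConformalEquiv UpperHalfPlane.upperHalfPlaneSet D.carrier), D.IsChordalUniformizing φ →
      ∀ (Φ : ConformalEquiv (UpperHalfPlane.upperHalfPlaneSet \ φ.pullbackHull D')
        UpperHalfPlane.upperHalfPlaneSet), IsRestrictionMap (φ.pullbackHull D') Φ →
      Tendsto (fun δ =>
        (rwGreen (SimpleGraph.fromRel fun x y => (discreteDomainGraph D.carrier δ).Adj x y ∧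
            (meshGraph D'.carrier δ).Adj x y ∧ x ∈ meshVertices D'.carrier δ ∧
            y ∈ meshVertices D'.carrier δ) (a δ) (b δ)).toReal /
          (rwGreen (discreteDomainGraph D.carrier δ) (a δ) (b δ)).toReal -
        Real.log (‖Φ (φ.symm (meshPoint δ (a δ))) - conj (Φ (φ.symm (meshPoint δ (b δ))))‖ /
            ‖Φ (φ.symm (meshPoint δ (a δ))) - Φ (φ.symm (meshPoint δ (b δ)))‖) /
          Real.log (‖φ.symm (meshPoint δ (a δ)) - conj (φ.symm (meshPoint δ (b δ)))‖ /
            ‖φ.symm (meshPoint δ (a δ)) - φ.symm (meshPoint δ (b δ))‖))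
        (𝓝[>] 0) (𝓝 0)) :
    AnchorExcursion := by
  unfold AnchorExcursion
  intro hull pb G m Z D D' hDD' a b hab φ hφ Φ d hΦ hd
  have hhull : D.IsHullSubdomain D' := hDD'
  have hpb : pb D φ D' = φ.pullbackHull D' := rfl
  obtain ⟨ε, hε, hb0, hb1⟩ := exists_ball_inter_eq hhull
  -- the continuum ratio at the uniformized legs tends to `d`
  have hstar : IsStarHull (φ.pullbackHull D') :=
    IsStarHull.pullbackHull JordanDomain.isSimplyConnected_holds hφ hhull
  have hcont := (AvoidanceLimit.Anchor.tendsto_greenHalfPlane_ratio _ hstar Φ d hΦ hd).comp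
    ((AvoidanceLimit.Anchor.tendsto_symm_meshPoint_fst hab hhull.carrier_subset hε hb0 hφ).prodMk
      (AvoidanceLimit.Anchor.tendsto_symm_meshPoint_snd hab hhull.carrier_subset hε hb1 hφ))
  -- hence, by the hypothesis, so does the lattice ratio
  have hsum := (hX D D' a b hab hhull φ hφ Φ hΦ).add hcont
  rw [zero_add] at hsum
  have hreal : Tendsto (fun δ => (rwGreen (G D.carrier D'.carrier δ) (a δ) (b δ)).toReal /
      (rwGreen (discreteDomainGraph D.carrier δ) (a δ) (b δ)).toReal) (𝓝[>] 0) (𝓝 d) := by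
    refine hsum.congr fun δ => ?_
    simp only [Function.comp_apply, sub_add_cancel]
    rfl
  -- and the item's quotient is that ratio for `δ > 0`
  refine ((Complex.continuous_ofReal.tendsto d).comp hreal).congr' ?_
  filter_upwards [self_mem_nhdsWithin] with δ hδ
  have hδ' : (0 : ℝ) < δ := hδ
  simp only [Z, m, Function.comp_apply]
  rw [Complex.ofReal_div]
  congr 1
  · exact (tsum_domainSAW_complex_eq (windowGraph_le D.carrier D'.carrier δ)
      (edgeSet_finite_of_le (windowGraph_le D.carrier D'.carrier δ) D.isBounded hδ')
      (a δ) (b δ) _ _).symm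
  · conv_lhs => rw [← windowGraph_self_eq D.carrier δ]
    exact (tsum_domainSAW_complex_eq (windowGraph_le D.carrier D.carrier δ)
      (edgeSet_finite_of_le (windowGraph_le D.carrier D.carrier δ) D.isBounded hδ')
      (a δ) (b δ) _ _).symm

end Summit.CriticalPhenomena.SAWScalingLimit.Theorems.AnchorExcursion

end
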